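import Literature.Analysis.FluidPDE.KatoLocalBoundedPicard
import Literature.Analysis.FluidPDE.BoundedRepresentative
import HarnessLib

/-!
# `L²`-stability of bounded solutions of the Oseen integral equation (the remainder equation)

Analysis/FluidPDE proofs file (theorems only) on the discharge path of the corrected form of
`Literature.Analysis.FluidPDE.albritton_singular_point_of_blowup` (Albritton 2018, Cor. 4.6 over
Albritton's class; `AlbrittonSingularPointKatoClass.lean`). In the proof of Prop. 4.5
(arXiv:1612.04439, p. 23) the datum is split `u₀ = U₀ + V₀`, `U₀ ∈ L²`, and "the remainder
`U = u - V` solves the perturbed Navier–Stokes equations (4.32) … By the well-posedness theory for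
the equation (4.32) … one may prove that `U` is in the energy space" — the first half of which is
that the difference of the two mild solutions `u = NS(u₀)`, `V = NS(V₀)` is square integrable at
all, with a bound, on every time block where both are bounded. In the tree's vocabulary (bounded
measurable fields solving the Oseen integral equation `w(t) = U_w(t) - B^ν_s(w,w)(t)` a.e.,
`KatoLocalBoundedPicard.lean`, `OseenMildUniqueness.lean`) this file proves:

* `exists_difference_solution` — **the linear remainder equation has an `L² ∩ L^∞` solution**: on
  a block `(s, T)` with `C M ν^{-1/2} 2√(T-s) ≤ 1/8`, for `u`, `v` measurable and bounded by `M` and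
  a free difference `U_d` measurable, bounded by `2M` and by `Λ` in `L²` on the block, the Picard
  iterates `Z⁰ = U_d`, `Z^{k+1} = U_d - B(Zᵏ, u) - B(v, Zᵏ)` converge uniformly to a measurable
  `Z`, bounded by `4M`, with `‖Z(t)‖_{L²} ≤ 2Λ`, solving `Z = U_d - B(Z, u) - B(v, Z)` pointwise
  (Lemarié-Rieusset 2016, Thm. 5.1, Picard's scheme, run for the linearised operator with the
  `L^p`-with-one-bounded-factor estimates of Prop. 7.3, here `p = 2`:
  `exists_eLpNorm_oseenDuhamel_le_left/right`, `exists_norm_oseenDuhamel_le_mul`);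
* `difference_ae_eq_of_linear` — **uniqueness for the linear remainder equation among bounded
  fields**: a bounded measurable `D` with `D(t) = -B(D,u)(t) - B(v,D)(t)` a.e. for every `t`
  vanishes a.e. at every `t` (the `L^∞` distance halves indefinitely; bounded representatives by
  the radial retraction of `BoundedRepresentative.lean`, as in `oseenMild_essBounded_unique`);
* `eLpNorm_two_sub_le_of_oseenMild` — **the `L²` bound of the difference**: if `u`, `v`, bounded by
  `M` on the block, solve `u(t) = U_u(t) - B(u,u)(t)`, `v(t) = U_v(t) - B(v,v)(t)` a.e. with
  `U_u - U_v = U_d` as above, then `u(t) - v(t)` is a.e. the solution `Z`, hence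
  `‖u(t) - v(t)‖_{L²} ≤ 2Λ` for every `t ∈ (s, T)` (bilinearity `B(u,u) - B(v,v) = B(u-v,u) + B(v,u-v)`,
  `oseenDuhamel_self_sub_self`). With `U_w(t) = e^{ν(t-s)Δ}w(s)` and `Λ = ‖u(s) - v(s)‖_{L²}`
  (`e^{σΔ}` is an `L²` contraction) this is the block estimate
  `‖u(t) - v(t)‖₂ ≤ 2‖u(s) - v(s)‖₂` iterated along Albritton's (4.33).

## Mathlib / tree search

Tree (reused): `oseenDuhamel`, `exists_norm_oseenDuhamel_le_mul`,
`exists_eLpNorm_oseenDuhamel_le_left`, `exists_eLpNorm_oseenDuhamel_le_right`,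
`aestronglyMeasurable_uncurry_oseenDuhamel`, `aestronglyMeasurable_oseenDuhamel`,
`oseenDuhamel_sub_left`, `oseenDuhamel_sub_right`, `oseenDuhamel_self_sub_self`,
`oseenDuhamel_congr_ae_slice` (`KatoLocalBoundedPicard`, `NSBoundedMildOseenDuhamel`);
`continuous_radialRetract`, `norm_radialRetract_le`, `radialRetract_eq_self`
(`BoundedRepresentative`). Mathlib: `cauchySeq_of_le_geometric`,
`dist_le_of_le_geometric_of_tendsto`, `aestronglyMeasurable_of_tendsto_ae`,
`Lp.eLpNorm_lim_le_liminf_eLpNorm`, `ae_all_iff`. `lean search 'oseenMild.*L2|difference_solution'`: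
nothing for the linearised equation.

## References

* D. Albritton, Anal. PDE 11 (2018) 1415–1456 = arXiv:1612.04439, proof of Prop. 4.5,
  (4.32)–(4.33). [Albritton2018]
* P. G. Lemarié-Rieusset, *The Navier–Stokes Problem in the 21st Century* (2016), Thm. 5.1
  (Picard's contraction, PDF pp. 103–105), Prop. 7.3 (7.32)–(7.33) (PDF p. 152), proof of
  Thm. 9.11 (pp. 256–257: "convergence … in `L^∞L²` as well"). [LemarieRieusset2016]
-/

noncomputable section

open MeasureTheory Set Function Filter TopologicalSpace InnerProductSpace Metric
open _root_.Topology
open scoped RealInnerProductSpace NNReal ENNReal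

namespace Literature.Analysis.FluidPDE

namespace OseenMildDifferenceL2

variable {E : Type*} [NormedAddCommGroup E] [InnerProductSpace ℝ E] [FiniteDimensional ℝ E]
  [MeasurableSpace E] [BorelSpace E]

/-- **Uniqueness for the linear remainder equation among bounded fields.** On a block `(s, T)`
with `C₁ M ν^{-1/2} 2√(T - s) ≤ 1/8` (`C₁` the constant of `exists_norm_oseenDuhamel_le_mul`), for
`u`, `v` measurable and bounded by `M` there: a measurable field `D`, bounded by `M_D`, with
`D(t) = -B^ν_s(D,u)(t) - B^ν_s(v,D)(t)` a.e. for every `t ∈ (s, T)`, vanishes a.e. at every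
`t ∈ (s, T)` (the a.e. bound halves at each application of the identity, run on bounded
representatives of the slices). [cite: LemarieRieusset2016, Thm. 5.1 (PDF pp. 103–105)] -/
theorem difference_ae_eq_zero_of_linear {C₁ : ℝ} (hC₁ : 0 < C₁)
    (hB : ∀ {ν : ℝ}, 0 < ν → ∀ {u v : ℝ → E → E} {s t Mu Mv : ℝ}, s < t → 0 ≤ Mu →
      0 ≤ Mv → (∀ τ ∈ Ioo s t, ∀ y, ‖u τ y‖ ≤ Mu) → (∀ τ ∈ Ioo s t, ∀ y, ‖v τ y‖ ≤ Mv) → ∀ x : E,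
        ‖oseenDuhamel ν s u v t x‖ ≤ C₁ * Mu * Mv * ν ^ (-(1 / 2 : ℝ)) * (2 * Real.sqrt (t - s)))
    {ν s T M M_D : ℝ} (hν : 0 < ν) (hM : 0 ≤ M) (hMD : 0 ≤ M_D)
    (hsmall : C₁ * M * ν ^ (-(1 / 2 : ℝ)) * (2 * Real.sqrt (T - s)) ≤ 1 / 8)
    {u v D : ℝ → E → E}
    (hDm : AEStronglyMeasurable (uncurry D) ((volume : Measure (ℝ × E)).restrict (Ioo s T ×ˢ univ)))
    (huM : ∀ τ ∈ Ioo s T, ∀ y, ‖u τ y‖ ≤ M) (hvM : ∀ τ ∈ Ioo s T, ∀ y, ‖v τ y‖ ≤ M)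
    (hDM : ∀ τ ∈ Ioo s T, ∀ y, ‖D τ y‖ ≤ M_D)
    (hD : ∀ t ∈ Ioo s T, D t =ᵐ[volume] fun x =>
      -oseenDuhamel ν s D u t x - oseenDuhamel ν s v D t x) :
    ∀ t ∈ Ioo s T, D t =ᵐ[volume] 0 := by
  -- the Lipschitz constant on the block
  set K : ℝ := C₁ * ν ^ (-(1 / 2 : ℝ)) * (2 * Real.sqrt (T - s)) with hK
  have hK0 : 0 ≤ K := by positivity
  have hKM : K * M ≤ 1 / 8 := by
    have : K * M = C₁ * M * ν ^ (-(1 / 2 : ℝ)) * (2 * Real.sqrt (T - s)) := by rw [hK]; ring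
    rwa [this]
  have hwt : ∀ {t : ℝ}, t ∈ Ioo s T → ∀ {A B : ℝ}, 0 ≤ A → 0 ≤ B →
      C₁ * A * B * ν ^ (-(1 / 2 : ℝ)) * (2 * Real.sqrt (t - s)) ≤ K * A * B := by
    intro t ht A B hA hB0
    rw [hK]
    have hst : Real.sqrt (t - s) ≤ Real.sqrt (T - s) := Real.sqrt_le_sqrt (by linarith [ht.2])
    calc C₁ * A * B * ν ^ (-(1 / 2 : ℝ)) * (2 * Real.sqrt (t - s))
        ≤ C₁ * A * B * ν ^ (-(1 / 2 : ℝ)) * (2 * Real.sqrt (T - s)) := by gcongr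
      _ = C₁ * ν ^ (-(1 / 2 : ℝ)) * (2 * Real.sqrt (T - s)) * A * B := by ring
  -- the a.e. bound halves indefinitely
  have hiter : ∀ n : ℕ, ∀ t ∈ Ioo s T, ∀ᵐ x ∂(volume : Measure E), ‖D t x‖ ≤ (M_D + 1) * (1 / 2) ^ n := by
    intro n
    induction n with
    | zero =>
      intro t ht
      exact Eventually.of_forall fun x => by
        rw [pow_zero, mul_one]; exact (hDM t ht x).trans (by linarith)
    | succ n ih =>
      intro t ht
      -- bounded representatives of the slices at level `c = (M_D + 1) 2^{-n}`
      set c : ℝ := (M_D + 1) * (1 / 2) ^ n with hc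
      have hcpos : 0 < c := by rw [hc]; positivity
      set ρ : E → E := fun w => (c / max c ‖w‖) • w with hρ
      have hρc : Continuous ρ := continuous_radialRetract hcpos
      set D' : ℝ → E → E := fun τ y => ρ (D τ y) with hD'
      have hD'm : AEStronglyMeasurable (uncurry D')
          ((volume : Measure (ℝ × E)).restrict (Ioo s T ×ˢ univ)) :=
        hρc.comp_aestronglyMeasurable hDm
      have hD'M : ∀ τ ∈ Ioo s T, ∀ y, ‖D' τ y‖ ≤ c := fun τ _ y => norm_radialRetract_le hcpos _
      have hD'D : ∀ τ ∈ Ioo s T, D' τ =ᵐ[volume] D τ := by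
        intro τ hτ
        filter_upwards [ih τ hτ] with y hy
        exact radialRetract_eq_self hcpos hy
      -- the Duhamel terms only see a.e. slices
      have hB₁ : ∀ x, oseenDuhamel ν s D u t x = oseenDuhamel ν s D' u t x := fun x =>
        oseenDuhamel_congr_ae_slice (fun τ hτ => (hD'D τ ⟨hτ.1, hτ.2.trans ht.2⟩).symm)
          (fun _ _ => EventuallyEq.rfl) x
      have hB₂ : ∀ x, oseenDuhamel ν s v D t x = oseenDuhamel ν s v D' t x := fun x =>
        oseenDuhamel_congr_ae_slice (fun _ _ => EventuallyEq.rfl)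
          (fun τ hτ => (hD'D τ ⟨hτ.1, hτ.2.trans ht.2⟩).symm) x
      filter_upwards [hD t ht] with x hx
      rw [hx, hB₁ x, hB₂ x]
      have h1 := hB hν ht.1 hcpos.le hM (fun τ hτ y => hD'M τ ⟨hτ.1, hτ.2.trans ht.2⟩ y)
        (fun τ hτ y => huM τ ⟨hτ.1, hτ.2.trans ht.2⟩ y) x
      have h2 := hB hν ht.1 hM hcpos.le (fun τ hτ y => hvM τ ⟨hτ.1, hτ.2.trans ht.2⟩ y)
        (fun τ hτ y => hD'M τ ⟨hτ.1, hτ.2.trans ht.2⟩ y) x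
      calc ‖-oseenDuhamel ν s D' u t x - oseenDuhamel ν s v D' t x‖
          ≤ ‖oseenDuhamel ν s D' u t x‖ + ‖oseenDuhamel ν s v D' t x‖ := by
            rw [← norm_neg (oseenDuhamel ν s D' u t x)]; exact norm_sub_le _ _
        _ ≤ K * c * M + K * M * c := add_le_add ((h1.trans (hwt ht hcpos.le hM)))
            (h2.trans (hwt ht hM hcpos.le))
        _ = 2 * (K * M) * c := by ring
        _ ≤ 2 * (1 / 8) * c := by gcongr
        _ ≤ (M_D + 1) * (1 / 2) ^ (n + 1) := by rw [hc, pow_succ]; nlinarith [pow_pos (by norm_num : (0:ℝ) < 1 / 2) n]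
  intro t ht
  have hall : ∀ᵐ x ∂(volume : Measure E), ∀ n : ℕ, ‖D t x‖ ≤ (M_D + 1) * (1 / 2) ^ n :=
    ae_all_iff.2 fun n => hiter n t ht
  filter_upwards [hall] with x hx
  have hlim : Tendsto (fun n : ℕ => (M_D + 1) * (1 / 2 : ℝ) ^ n) atTop (𝓝 0) := by
    have h := (tendsto_pow_atTop_nhds_zero_of_lt_one (by norm_num : (0:ℝ) ≤ 1 / 2)
      (by norm_num : (1 / 2 : ℝ) < 1)).const_mul (M_D + 1)
    rwa [mul_zero] at h
  have h0 : ‖D t x‖ ≤ 0 := ge_of_tendsto' hlim hx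
  exact norm_le_zero_iff.1 h0

/-- **The linear remainder equation has an `L² ∩ L^∞` solution, and it is the difference.** There is
`C = C(E) > 0` such that: on a block `(s, T)`, `ν > 0`, with `C M ν^{-1/2} 2√(T - s) ≤ 1/8`, for
jointly measurable `u`, `v` bounded by `M > 0` on `(s, T) × E` and a jointly measurable free
difference `U_d`, bounded by `2M`, with measurable slices and `‖U_d(t)‖_{L²} ≤ Λ` on `(s, T)`, if
`u(t) - v(t) = U_d(t) - (B^ν_s(u,u)(t) - B^ν_s(v,v)(t))` a.e. for every `t ∈ (s, T)` (as when `u`,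
`v` solve the Oseen integral equations with free terms `U_u`, `U_v`, `U_u - U_v = U_d`), then for
every `t ∈ (s, T)` the difference `u(t) - v(t)` is a.e. strongly measurable with
`‖u(t) - v(t)‖_{L²} ≤ 2Λ`. Proof: the Picard iterates `Z⁰ = U_d`, `Z^{k+1} = U_d - B(Zᵏ,u) - B(v,Zᵏ)`
stay bounded by `4M` and by `2Λ` in `L²` (`exists_norm_oseenDuhamel_le_mul`,
`exists_eLpNorm_oseenDuhamel_le_left/right` with `p = 2`), converge geometrically in `L^∞` to a
solution `Z` with the same bounds (Fatou), and `u - v - Z` solves the homogeneous linear equation,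
hence vanishes a.e. (`difference_ae_eq_zero_of_linear`). [cite: LemarieRieusset2016, Thm. 5.1 (PDF pp. 103–105) and Thm. 9.11 (proof, pp. 256–257)] -/
theorem eLpNorm_two_sub_le_of_oseenMild :
    ∃ C : ℝ, 0 < C ∧ ∀ {ν s T M : ℝ} {u v Ud : ℝ → E → E} {Λ : ℝ≥0∞}, 0 < ν → s < T → 0 < M →
      AEStronglyMeasurable (uncurry u) ((volume : Measure (ℝ × E)).restrict (Ioo s T ×ˢ univ)) →
      AEStronglyMeasurable (uncurry v) ((volume : Measure (ℝ × E)).restrict (Ioo s T ×ˢ univ)) →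
      AEStronglyMeasurable (uncurry Ud) ((volume : Measure (ℝ × E)).restrict (Ioo s T ×ˢ univ)) →
      (∀ t ∈ Ioo s T, ∀ x, ‖u t x‖ ≤ M) → (∀ t ∈ Ioo s T, ∀ x, ‖v t x‖ ≤ M) →
      (∀ t ∈ Ioo s T, ∀ x, ‖Ud t x‖ ≤ 2 * M) →
      (∀ t ∈ Ioo s T, AEStronglyMeasurable (Ud t) volume) →
      (∀ t ∈ Ioo s T, eLpNorm (Ud t) 2 volume ≤ Λ) →
      (∀ t ∈ Ioo s T, (fun x => u t x - v t x) =ᵐ[volume] fun x =>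
        Ud t x - (oseenDuhamel ν s u u t x - oseenDuhamel ν s v v t x)) →
      C * M * ν ^ (-(1 / 2 : ℝ)) * (2 * Real.sqrt (T - s)) ≤ 1 / 8 →
      ∀ t ∈ Ioo s T, AEStronglyMeasurable (fun x => u t x - v t x) volume ∧
        eLpNorm (fun x => u t x - v t x) 2 volume ≤ 2 * Λ := by
  obtain ⟨C₁, hC₁, hBsup⟩ := exists_norm_oseenDuhamel_le_mul (E := E)
  obtain ⟨C₂, hC₂, hBl⟩ := exists_eLpNorm_oseenDuhamel_le_left (E := E)
  obtain ⟨C₃, hC₃, hBr⟩ := exists_eLpNorm_oseenDuhamel_le_right (E := E)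
  set C : ℝ := max C₁ (max C₂ C₃) with hC_def
  have hC₁le : C₁ ≤ C := le_max_left _ _
  have hC₂le : C₂ ≤ C := (le_max_left _ _).trans (le_max_right _ _)
  have hC₃le : C₃ ≤ C := (le_max_right _ _).trans (le_max_right _ _)
  refine ⟨C, lt_max_of_lt_left hC₁, ?_⟩
  intro ν s T M u v Ud Λ hν hsT hM hum hvm hUdm huM hvM hUdM hUdsl hUdL2 hW hsmall
  have h12 : (1 : ℝ≥0∞) ≤ 2 := by norm_num
  have h2t : (2 : ℝ≥0∞) ≠ ⊤ := ENNReal.ofNat_ne_top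
  -- the Lipschitz constant `K = C ν^{-1/2} 2√(T-s)`, `K M ≤ 1/8`
  set K : ℝ := C * ν ^ (-(1 / 2 : ℝ)) * (2 * Real.sqrt (T - s)) with hK_def
  have hK0 : 0 ≤ K := by positivity
  have hKM : K * M ≤ 1 / 8 := by
    have : K * M = C * M * ν ^ (-(1 / 2 : ℝ)) * (2 * Real.sqrt (T - s)) := by rw [hK_def]; ring
    rwa [this]
  have hwt : ∀ {t : ℝ}, t ∈ Ioo s T → ∀ {C' : ℝ}, 0 ≤ C' → C' ≤ C → ∀ {A : ℝ}, 0 ≤ A →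
      C' * A * ν ^ (-(1 / 2 : ℝ)) * (2 * Real.sqrt (t - s)) ≤ K * A := by
    intro t ht C' hC' hC'C A hA
    rw [hK_def]
    have hst : Real.sqrt (t - s) ≤ Real.sqrt (T - s) := Real.sqrt_le_sqrt (by linarith [ht.2])
    calc C' * A * ν ^ (-(1 / 2 : ℝ)) * (2 * Real.sqrt (t - s))
        ≤ C * A * ν ^ (-(1 / 2 : ℝ)) * (2 * Real.sqrt (T - s)) := by gcongr
      _ = C * ν ^ (-(1 / 2 : ℝ)) * (2 * Real.sqrt (T - s)) * A := by ring
  set μ : Measure (ℝ × E) := (volume : Measure (ℝ × E)).restrict (Ioo s T ×ˢ univ) with hμ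
  -- (B1) the sup bound, (B2)/(B3) the `L²` bounds with one bounded factor, on the block
  have B1 : ∀ {f g : ℝ → E → E} {Mf Mg : ℝ}, 0 ≤ Mf → 0 ≤ Mg →
      (∀ τ ∈ Ioo s T, ∀ y, ‖f τ y‖ ≤ Mf) → (∀ τ ∈ Ioo s T, ∀ y, ‖g τ y‖ ≤ Mg) →
      ∀ t ∈ Ioo s T, ∀ x, ‖oseenDuhamel ν s f g t x‖ ≤ K * Mf * Mg := by
    intro f g Mf Mg hMf hMg hf hg t ht x
    have h := hBsup hν ht.1 hMf hMg (fun τ hτ y => hf τ ⟨hτ.1, hτ.2.trans ht.2⟩ y)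
      (fun τ hτ y => hg τ ⟨hτ.1, hτ.2.trans ht.2⟩ y) x
    calc ‖oseenDuhamel ν s f g t x‖ ≤ C₁ * Mf * Mg * ν ^ (-(1 / 2 : ℝ)) * (2 * Real.sqrt (t - s)) := h
      _ = C₁ * (Mf * Mg) * ν ^ (-(1 / 2 : ℝ)) * (2 * Real.sqrt (t - s)) := by ring
      _ ≤ K * (Mf * Mg) := hwt ht hC₁.le hC₁le (mul_nonneg hMf hMg)
      _ = K * Mf * Mg := by ring
  have B2 : ∀ {f g : ℝ → E → E} {Mf Mg : ℝ}, AEStronglyMeasurable (uncurry f) μ →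
      AEStronglyMeasurable (uncurry g) μ → 0 ≤ Mf →
      (∀ τ ∈ Ioo s T, ∀ y, ‖f τ y‖ ≤ Mf) → (∀ τ ∈ Ioo s T, ∀ y, ‖g τ y‖ ≤ Mg) →
      ∀ {L : ℝ≥0∞}, (∀ τ ∈ Ioo s T, eLpNorm (g τ) 2 volume ≤ L) →
      ∀ t ∈ Ioo s T, eLpNorm (oseenDuhamel ν s f g t) 2 volume ≤ ENNReal.ofReal (K * Mf) * L := by
    intro f g Mf Mg hf hg hMf hfM hgM L hL t ht
    refine (hBl hν hf hg hMf hfM hgM h12 h2t hL ht.1 ht.2.le).trans ?_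
    exact mul_le_mul_left (ENNReal.ofReal_le_ofReal (hwt ht hC₂.le hC₂le hMf)) L
  have B3 : ∀ {f g : ℝ → E → E} {Mf Mg : ℝ}, AEStronglyMeasurable (uncurry f) μ →
      AEStronglyMeasurable (uncurry g) μ → 0 ≤ Mg →
      (∀ τ ∈ Ioo s T, ∀ y, ‖f τ y‖ ≤ Mf) → (∀ τ ∈ Ioo s T, ∀ y, ‖g τ y‖ ≤ Mg) →
      ∀ {L : ℝ≥0∞}, (∀ τ ∈ Ioo s T, eLpNorm (f τ) 2 volume ≤ L) →
      ∀ t ∈ Ioo s T, eLpNorm (oseenDuhamel ν s f g t) 2 volume ≤ ENNReal.ofReal (K * Mg) * L := by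
    intro f g Mf Mg hf hg hMg hfM hgM L hL t ht
    refine (hBr hν hf hg hMg hfM hgM h12 h2t hL ht.1 ht.2.le).trans ?_
    exact mul_le_mul_left (ENNReal.ofReal_le_ofReal (hwt ht hC₃.le hC₃le hMg)) L
  have hM0 : 0 ≤ M := hM.le
  have hM2 : 0 ≤ 2 * M := by positivity
  have hM4 : 0 ≤ 4 * M := by positivity
  have h14 : ENNReal.ofReal (1 / 8) * (2 * Λ) + ENNReal.ofReal (1 / 8) * (2 * Λ) ≤ Λ := by
    have e : ENNReal.ofReal (1 / 8) * (2 * Λ) + ENNReal.ofReal (1 / 8) * (2 * Λ) =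
        ENNReal.ofReal (1 / 2) * Λ := by
      rw [← mul_assoc, ← add_mul, ← ENNReal.ofReal_ofNat 2, ← ENNReal.ofReal_mul (by norm_num),
        ← ENNReal.ofReal_add (by norm_num) (by norm_num)]
      norm_num
    rw [e]
    exact mul_le_of_le_one_left zero_le (ENNReal.ofReal_le_one.2 (by norm_num))
  -- the linear scheme
  set Ψ : (ℝ → E → E) → ℝ → E → E := fun Z t x =>
    Ud t x - oseenDuhamel ν s Z u t x - oseenDuhamel ν s v Z t x with hΨ_def
  set Zseq : ℕ → ℝ → E → E := fun k => Ψ^[k] Ud with hZseq_def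
  have Zseq_zero : Zseq 0 = Ud := rfl
  have Zseq_succ : ∀ k, Zseq (k + 1) = Ψ (Zseq k) := fun k => Function.iterate_succ_apply' Ψ k Ud
  -- invariants of the iterates
  have hP : ∀ k, AEStronglyMeasurable (uncurry (Zseq k)) μ ∧
      (∀ t ∈ Ioo s T, ∀ x, ‖Zseq k t x‖ ≤ 4 * M) ∧
      (∀ t ∈ Ioo s T, eLpNorm (Zseq k t) 2 volume ≤ 2 * Λ) ∧
      (∀ t ∈ Ioo s T, AEStronglyMeasurable (Zseq k t) volume) := by
    intro k
    induction k with
    | zero =>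
      refine ⟨hUdm, fun t ht x => (hUdM t ht x).trans (by linarith), fun t ht =>
        (hUdL2 t ht).trans ?_, hUdsl⟩
      exact le_mul_of_one_le_left zero_le (by norm_num)
    | succ k ih =>
      obtain ⟨hm, hbd, hlp, hsl⟩ := ih
      have hBm₁ := aestronglyMeasurable_uncurry_oseenDuhamel hν hm hum hbd huM
      have hBm₂ := aestronglyMeasurable_uncurry_oseenDuhamel hν hvm hm hvM hbd
      have hbd' : ∀ τ ∈ Ioo s T, ∀ y, ‖Zseq k τ y‖ ≤ max (4 * M) M := fun τ hτ y =>
        (hbd τ hτ y).trans (le_max_left _ _)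
      have huM' : ∀ τ ∈ Ioo s T, ∀ y, ‖u τ y‖ ≤ max (4 * M) M := fun τ hτ y =>
        (huM τ hτ y).trans (le_max_right _ _)
      have hvM' : ∀ τ ∈ Ioo s T, ∀ y, ‖v τ y‖ ≤ max (4 * M) M := fun τ hτ y =>
        (hvM τ hτ y).trans (le_max_right _ _)
      have hBsl₁ : ∀ t ∈ Ioo s T, AEStronglyMeasurable (oseenDuhamel ν s (Zseq k) u t) volume :=
        fun t ht => aestronglyMeasurable_oseenDuhamel hν hm hum (hM4.trans (le_max_left _ _))
          hbd' huM' ht.1 ht.2.le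
      have hBsl₂ : ∀ t ∈ Ioo s T, AEStronglyMeasurable (oseenDuhamel ν s v (Zseq k) t) volume :=
        fun t ht => aestronglyMeasurable_oseenDuhamel hν hvm hm (hM4.trans (le_max_left _ _))
          hvM' hbd' ht.1 ht.2.le
      rw [Zseq_succ]
      refine ⟨(hUdm.sub hBm₁).sub hBm₂, fun t ht x => ?_, fun t ht => ?_, fun t ht =>
        ((hUdsl t ht).sub (hBsl₁ t ht)).sub (hBsl₂ t ht)⟩
      · -- sup bound: `2M + K (4M) M + K M (4M) ≤ 4M`
        have h1 := B1 hM4 hM0 hbd huM t ht x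
        have h2 := B1 hM0 hM4 hvM hbd t ht x
        calc ‖Ψ (Zseq k) t x‖ ≤ ‖Ud t x‖ + ‖oseenDuhamel ν s (Zseq k) u t x‖ +
              ‖oseenDuhamel ν s v (Zseq k) t x‖ := by
              calc ‖Ψ (Zseq k) t x‖
                  ≤ ‖Ud t x - oseenDuhamel ν s (Zseq k) u t x‖ + ‖oseenDuhamel ν s v (Zseq k) t x‖ :=
                    norm_sub_le _ _
                _ ≤ _ := by gcongr; exact norm_sub_le _ _
          _ ≤ 2 * M + K * (4 * M) * M + K * M * (4 * M) := add_le_add (add_le_add (hUdM t ht x) h1) h2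
          _ = 2 * M + 8 * (K * M) * M := by ring
          _ ≤ 2 * M + 8 * (1 / 8) * M := by gcongr
          _ ≤ 4 * M := by linarith
      · -- `L²` bound: `Λ + K M (2Λ) + K M (2Λ) ≤ 2Λ`
        have h1 := B3 hm hum hM0 hbd huM hlp t ht
        have h2 := B2 hvm hm hM0 hvM hbd hlp t ht
        calc eLpNorm (Ψ (Zseq k) t) 2 volume
            ≤ eLpNorm (fun x => Ud t x - oseenDuhamel ν s (Zseq k) u t x) 2 volume +
                eLpNorm (oseenDuhamel ν s v (Zseq k) t) 2 volume :=
              eLpNorm_sub_le ((hUdsl t ht).sub (hBsl₁ t ht)) (hBsl₂ t ht) h12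
          _ ≤ (eLpNorm (Ud t) 2 volume + eLpNorm (oseenDuhamel ν s (Zseq k) u t) 2 volume) +
                eLpNorm (oseenDuhamel ν s v (Zseq k) t) 2 volume := by
              gcongr; exact eLpNorm_sub_le (hUdsl t ht) (hBsl₁ t ht) h12
          _ ≤ (Λ + ENNReal.ofReal (K * M) * (2 * Λ)) + ENNReal.ofReal (K * M) * (2 * Λ) :=
              add_le_add (add_le_add (hUdL2 t ht) h1) h2
          _ ≤ (Λ + ENNReal.ofReal (1 / 8) * (2 * Λ)) + ENNReal.ofReal (1 / 8) * (2 * Λ) := by gcongr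
          _ = Λ + (ENNReal.ofReal (1 / 8) * (2 * Λ) + ENNReal.ofReal (1 / 8) * (2 * Λ)) := add_assoc _ _ _
          _ ≤ Λ + Λ := add_le_add le_rfl h14
          _ = 2 * Λ := (two_mul Λ).symm
  -- geometric decay of the differences in `L^∞`
  have hD : ∀ k, ∀ t ∈ Ioo s T, ∀ x, ‖Zseq (k + 1) t x - Zseq k t x‖ ≤ M * (1 / 2) ^ k := by
    intro k
    induction k with
    | zero =>
      intro t ht x
      -- `Z¹ - Z⁰ = -B(Ud, u) - B(v, Ud)`
      have hdiff : Zseq 1 t x - Zseq 0 t x =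
          -(oseenDuhamel ν s Ud u t x + oseenDuhamel ν s v Ud t x) := by
        rw [Zseq_succ, Zseq_zero]
        show Ud t x - oseenDuhamel ν s Ud u t x - oseenDuhamel ν s v Ud t x - Ud t x = _
        abel
      rw [hdiff, norm_neg, pow_zero, mul_one]
      have h1 := B1 hM2 hM0 hUdM huM t ht x
      have h2 := B1 hM0 hM2 hvM hUdM t ht x
      calc ‖oseenDuhamel ν s Ud u t x + oseenDuhamel ν s v Ud t x‖
          ≤ K * (2 * M) * M + K * M * (2 * M) := (norm_add_le _ _).trans (add_le_add h1 h2)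
        _ = 4 * (K * M) * M := by ring
        _ ≤ 4 * (1 / 8) * M := by gcongr
        _ ≤ M := by linarith
    | succ k ih =>
      intro t ht x
      obtain ⟨hm₁, hbd₁, -, -⟩ := hP (k + 1)
      obtain ⟨hm₀, hbd₀, -, -⟩ := hP k
      have hwm : AEStronglyMeasurable (uncurry fun t x => Zseq (k + 1) t x - Zseq k t x) μ :=
        hm₁.sub hm₀
      have hwA : 0 ≤ M * (1 / 2) ^ k := by positivity
      have hwbd : ∀ t ∈ Ioo s T, ∀ x, ‖(fun t x => Zseq (k + 1) t x - Zseq k t x) t x‖ ≤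
          M * (1 / 2) ^ k := ih
      have hident : Zseq (k + 2) t x - Zseq (k + 1) t x =
          -(oseenDuhamel ν s (fun t x => Zseq (k + 1) t x - Zseq k t x) u t x +
            oseenDuhamel ν s v (fun t x => Zseq (k + 1) t x - Zseq k t x) t x) := by
        have e1 : Zseq (k + 1) t x =
            Ud t x - oseenDuhamel ν s (Zseq k) u t x - oseenDuhamel ν s v (Zseq k) t x := by
          rw [Zseq_succ]
        have e2 : Zseq (k + 2) t x =
            Ud t x - oseenDuhamel ν s (Zseq (k + 1)) u t x - oseenDuhamel ν s v (Zseq (k + 1)) t x := by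
          show Zseq (k + 1 + 1) t x = _
          rw [Zseq_succ (k + 1)]
        rw [e2, e1, oseenDuhamel_sub_left hν hm₁ hm₀ hum hbd₁ hbd₀ huM ht.1 ht.2.le x,
          oseenDuhamel_sub_right hν hvm hm₁ hm₀ hvM hbd₁ hbd₀ ht.1 ht.2.le x]
        abel
      rw [hident, norm_neg]
      have h1 := B1 hwA hM0 hwbd huM t ht x
      have h2 := B1 hM0 hwA hvM hwbd t ht x
      calc ‖oseenDuhamel ν s (fun t x => Zseq (k + 1) t x - Zseq k t x) u t x +
            oseenDuhamel ν s v (fun t x => Zseq (k + 1) t x - Zseq k t x) t x‖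
          ≤ K * (M * (1 / 2) ^ k) * M + K * M * (M * (1 / 2) ^ k) :=
            (norm_add_le _ _).trans (add_le_add h1 h2)
        _ = 2 * (K * M) * (M * (1 / 2) ^ k) := by ring
        _ ≤ 2 * (1 / 8) * (M * (1 / 2) ^ k) := by gcongr
        _ ≤ M * (1 / 2) ^ (k + 1) := by
            rw [pow_succ]; nlinarith [pow_pos (by norm_num : (0:ℝ) < 1 / 2) k]
  -- the limit field
  set Z : ℝ → E → E := fun t x => limUnder atTop (fun k => Zseq k t x) with hZ_def
  have hconv : ∀ t ∈ Ioo s T, ∀ x, Tendsto (fun k => Zseq k t x) atTop (𝓝 (Z t x)) := by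
    intro t ht x
    have hc : CauchySeq fun k => Zseq k t x := by
      refine cauchySeq_of_le_geometric (1 / 2) M (by norm_num) fun k => ?_
      rw [dist_eq_norm, ← norm_neg, neg_sub]
      exact hD k t ht x
    exact tendsto_nhds_limUnder (cauchySeq_tendsto_of_complete hc)
  have hdist : ∀ t ∈ Ioo s T, ∀ x k, ‖Z t x - Zseq k t x‖ ≤ 2 * M * (1 / 2) ^ k := by
    intro t ht x k
    have h := dist_le_of_le_geometric_of_tendsto (1 / 2) M (by norm_num)
      (fun n => by rw [dist_eq_norm, ← norm_neg, neg_sub]; exact hD n t ht x) (hconv t ht x) k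
    rw [dist_comm, dist_eq_norm] at h
    refine h.trans (le_of_eq ?_)
    field_simp
    ring
  have hm_Z : AEStronglyMeasurable (uncurry Z) μ := by
    refine aestronglyMeasurable_of_tendsto_ae atTop (fun k => (hP k).1) ?_
    rw [hμ]
    filter_upwards [ae_restrict_mem (measurableSet_Ioo.prod MeasurableSet.univ)] with q hq
    exact hconv q.1 (mem_prod.1 hq).1 q.2
  have hbd_Z : ∀ t ∈ Ioo s T, ∀ x, ‖Z t x‖ ≤ 4 * M := fun t ht x =>
    le_of_tendsto ((hconv t ht x).norm) (Eventually.of_forall fun k => (hP k).2.1 t ht x)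
  have hsl_Z : ∀ t ∈ Ioo s T, AEStronglyMeasurable (Z t) volume := fun t ht =>
    aestronglyMeasurable_of_tendsto_ae atTop (fun k => (hP k).2.2.2 t ht)
      (Eventually.of_forall fun x => hconv t ht x)
  have hlp_Z : ∀ t ∈ Ioo s T, eLpNorm (Z t) 2 volume ≤ 2 * Λ := by
    intro t ht
    refine (Lp.eLpNorm_lim_le_liminf_eLpNorm (fun k => (hP k).2.2.2 t ht) (Z t)
      (Eventually.of_forall fun x => hconv t ht x)).trans ?_
    exact le_trans liminf_le_limsup (le_trans limsup_le_iSup (iSup_le fun k => (hP k).2.2.1 t ht))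
  -- the fixed-point identity `Z = Ud - B(Z,u) - B(v,Z)`, pointwise
  have hfix : ∀ t ∈ Ioo s T, ∀ x,
      Z t x = Ud t x - oseenDuhamel ν s Z u t x - oseenDuhamel ν s v Z t x := by
    intro t ht x
    have h1 : Tendsto (fun k => Zseq (k + 1) t x) atTop (𝓝 (Z t x)) :=
      (hconv t ht x).comp (tendsto_add_atTop_nat 1)
    have h2 : Tendsto (fun k => Zseq (k + 1) t x) atTop
        (𝓝 (Ud t x - oseenDuhamel ν s Z u t x - oseenDuhamel ν s v Z t x)) := by
      have heq : ∀ k, Zseq (k + 1) t x =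
          Ud t x - oseenDuhamel ν s (Zseq k) u t x - oseenDuhamel ν s v (Zseq k) t x := fun k => by
        rw [Zseq_succ]
      simp_rw [heq]
      have hbound : ∀ k, ‖(Ud t x - oseenDuhamel ν s (Zseq k) u t x - oseenDuhamel ν s v (Zseq k) t x) -
          (Ud t x - oseenDuhamel ν s Z u t x - oseenDuhamel ν s v Z t x)‖ ≤
          2 * (K * M) * (2 * M * (1 / 2) ^ k) := fun k => by
        obtain ⟨hmk, hbdk, -, -⟩ := hP k
        have hwA : 0 ≤ 2 * M * (1 / 2) ^ k := by positivity
        have hwbd : ∀ τ ∈ Ioo s T, ∀ y, ‖Zseq k τ y - Z τ y‖ ≤ 2 * M * (1 / 2) ^ k :=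
          fun τ hτ y => by rw [← norm_neg, neg_sub]; exact hdist τ hτ y k
        have e : (Ud t x - oseenDuhamel ν s (Zseq k) u t x - oseenDuhamel ν s v (Zseq k) t x) -
            (Ud t x - oseenDuhamel ν s Z u t x - oseenDuhamel ν s v Z t x) =
            -(oseenDuhamel ν s (fun τ y => Zseq k τ y - Z τ y) u t x +
              oseenDuhamel ν s v (fun τ y => Zseq k τ y - Z τ y) t x) := by
          rw [oseenDuhamel_sub_left hν hmk hm_Z hum hbdk hbd_Z huM ht.1 ht.2.le x,
            oseenDuhamel_sub_right hν hvm hmk hm_Z hvM hbdk hbd_Z ht.1 ht.2.le x]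
          abel
        rw [e, norm_neg]
        have ha' := B1 hwA hM0 hwbd huM t ht x
        have hb' := B1 hM0 hwA hvM hwbd t ht x
        calc ‖oseenDuhamel ν s (fun τ y => Zseq k τ y - Z τ y) u t x +
              oseenDuhamel ν s v (fun τ y => Zseq k τ y - Z τ y) t x‖
            ≤ K * (2 * M * (1 / 2) ^ k) * M + K * M * (2 * M * (1 / 2) ^ k) :=
              (norm_add_le _ _).trans (add_le_add ha' hb')
          _ = 2 * (K * M) * (2 * M * (1 / 2) ^ k) := by ring
      have hlim0 : Tendsto (fun k : ℕ => 2 * (K * M) * (2 * M * (1 / 2 : ℝ) ^ k)) atTop (𝓝 0) := by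
        have h := (tendsto_pow_atTop_nhds_zero_of_lt_one (by norm_num : (0:ℝ) ≤ 1 / 2)
          (by norm_num : (1 / 2 : ℝ) < 1)).const_mul (2 * (K * M) * (2 * M))
        rw [mul_zero] at h
        refine h.congr fun k => ?_
        ring
      rw [tendsto_iff_norm_sub_tendsto_zero]
      exact squeeze_zero (fun k => norm_nonneg _) hbound hlim0
    exact tendsto_nhds_unique h1 h2
  -- the difference `u - v - Z` solves the homogeneous linear equation, hence vanishes a.e.
  set W : ℝ → E → E := fun t x => u t x - v t x with hW_def
  have hWm : AEStronglyMeasurable (uncurry W) μ := hum.sub hvm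
  have hWbd : ∀ τ ∈ Ioo s T, ∀ y, ‖W τ y‖ ≤ 2 * M := fun τ hτ y =>
    (norm_sub_le _ _).trans (by linarith [huM τ hτ y, hvM τ hτ y])
  set Dd : ℝ → E → E := fun t x => W t x - Z t x with hDd_def
  have hDdm : AEStronglyMeasurable (uncurry Dd) μ := hWm.sub hm_Z
  have hDdbd : ∀ τ ∈ Ioo s T, ∀ y, ‖Dd τ y‖ ≤ 6 * M := fun τ hτ y =>
    (norm_sub_le _ _).trans (by linarith [hWbd τ hτ y, hbd_Z τ hτ y])
  have hDd : ∀ t ∈ Ioo s T, Dd t =ᵐ[volume] fun x =>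
      -oseenDuhamel ν s Dd u t x - oseenDuhamel ν s v Dd t x := by
    intro t ht
    filter_upwards [hW t ht] with x hx
    have hx' : W t x = Ud t x - (oseenDuhamel ν s u u t x - oseenDuhamel ν s v v t x) := hx
    show W t x - Z t x = _
    rw [hx', oseenDuhamel_self_sub_self hν hum hvm huM hvM ht.1 ht.2.le x, hfix t ht x,
      oseenDuhamel_sub_left hν hWm hm_Z hum hWbd hbd_Z huM ht.1 ht.2.le x,
      oseenDuhamel_sub_right hν hvm hWm hm_Z hvM hWbd hbd_Z ht.1 ht.2.le x]
    abel
  have hsmall₁ : C₁ * M * ν ^ (-(1 / 2 : ℝ)) * (2 * Real.sqrt (T - s)) ≤ 1 / 8 :=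
    le_trans (by gcongr) hsmall
  have hzero := difference_ae_eq_zero_of_linear hC₁ (fun hν' => hBsup hν') hν hM0 (by positivity)
    hsmall₁ hDdm huM hvM hDdbd hDd
  -- conclusion
  intro t ht
  have hae : (fun x => u t x - v t x) =ᵐ[volume] Z t := by
    filter_upwards [hzero t ht] with x hx
    have hx' : W t x - Z t x = 0 := hx
    exact sub_eq_zero.1 hx'
  exact ⟨(hsl_Z t ht).congr hae.symm, (eLpNorm_congr_ae hae).trans_le (hlp_Z t ht)⟩

end OseenMildDifferenceL2

end Literature.Analysis.FluidPDE

end
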